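import Summits.QuantumFields.YangMills.Theorems.FluctuationComparisonRegPrIntLSupTailCoverUnionDepthOne
import HarnessLib

/-!
# `FluctuationComparisonRegPrIntLSupTailCoverUnionTotal` — THE TOTAL-MASS EDITION OF THE UNION GLUE: regime ∕ pinned rows dominated by the TOTAL mass above `B` (not by the good
# mass), bad fraction `≤ ½` ⇒ COND-ODDS with `e^{2·Σσ}`; depth one, full and interior window, down to TAILSUP₁ ∕ TAILSUP₁∘ verbatim
# (crux `UnitScaleTilt.FluctuationComparisonRegPrIntL`, stmt-QuantumFields-20520; companion of ✓L `…SupTailCoverUnion`, ✓M `…SupTailCoverUnionDepthOne`, ✓B `…SupTailModulus`)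

Cell `ym3-torus` (YM ladder rung R3 = continuum SU(2) Yang–Mills on T³ — a RUNG, NOT the Clay problem: not d = 4, not infinite volume, not a mass gap);
width seat `ym-ust-20520-w3` (gen 17); helper `--supports stmt-QuantumFields-20520`.  THEOREMS ONLY (0 `def`, 0 `sorry`, default heartbeats).

WHY THIS EDITION.  ✓L ∕ ✓M take rows dominated by the GOOD mass `μ(D⁻¹B ∩ E) ≤ σ·μ(D⁻¹B ∩ histGood)`.  At depth one the good event IS the fine window, so a far-pinned row
relative to the good mass presupposes the window odds it is meant to prove; what the far door ✓H `gibbsK_restrict_map_farPinned_le` with ✓I (Jensen, `G := univ`) actually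
delivers is a row relative to the TOTAL mass `μ(D⁻¹B ∩ E_p) ≤ σ_p·μ(D⁻¹B)`.  Such rows close COND-ODDS through the bad FRACTION: `μ(D⁻¹B ∖ G) ≤ (Σσ)·μ(D⁻¹B)`, and
`Σσ ≤ ½` gives `μ(D⁻¹B) ≤ e^{2Σσ}·μ(D⁻¹B ∩ G)` (✓B `measure_le_exp_mul_inter_of_badFraction`).  The price is the smallness `Σσ ≤ ½` at EVERY `J` (Bałaban's large `p₀`:
`pFun b₀ p₀ g = b₀(1 + log g⁻¹)^{p₀}`), carried here as an explicit hypothesis `s J ≤ ½`.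
* §1 (generic) ★`measure_diff_le_sum_mul_of_cover` (`A ∖ G ⊆ ⋃ E_i`, `μ(A ∩ E_i) ≤ σ_i·μ A` ⇒ `μ(A ∖ G) ≤ (Σσ_i)·μ A`) · ★★`measure_le_exp_mul_inter_of_cover_total` (finite `μ`,
  real weights `σ_i ≥ 0`, `Σσ_i ≤ ½` ⇒ `μ A ≤ ofReal(e^{2Σσ})·μ(A ∩ G)`).
* §2 (runs, any depth, thresholds free) ★★`condGoodOdds_of_regimeCoverTotal`.
* §3 (depth one, fine plaquettes) ★★`condGoodOddsDepthOne_of_pinnedRowsFineTotal` (`μ(D⁻¹B ∩ {θ_{J+1} ≤ dist1(U(∂p))}) ≤ ofReal(σ_p)·μ(D⁻¹B)`, `Σ_p σ_p ≤ ½`, `B ⊆ {PlaqSmall(θ J)}`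
  ⇒ COND-ODDS at `(J, J+1)` with `e^{2Σσ}`).
* §4 ★★★`condGoodOddsDepthOneInt_of_pinnedTotalFineInt : ⟨PINNED-TOTAL₁∘⟩ → ✓K's ⟨COND-ODDS₁∘⟩ verbatim` (`τ J = 2·s J`) · ★★★`windowOddsSupDepthOneInt_of_pinnedTotalFineInt :
  ⟨PINNED-TOTAL₁∘⟩ → TAILSUP₁∘ `WindowOddsSupDepthOneIntCan` verbatim`; §5 the full-window twins `…_of_pinnedTotalFine` (⇒ ✓A's ⟨COND-ODDS₁⟩ ⇒ TAILSUP₁ verbatim).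
HONEST SCOPE.  Measure arithmetic; the total-mass pinned rows and their smallness `s J ≤ ½` are the HYPOTHESIS; TAILSUP₁, TAILSUP₁∘, MOD₁∘, FAR₁, LFR♯ᶜ∘, S2β, 20520,
`YM3TorusSU2` NOT proved; the Yang–Mills mass gap is NOT proved.
References: [Balaban1985UV3] (2) p. 256, (7) p. 257, (38)–(40) p. 266, (71) p. 273.
-/

noncomputable section

set_option autoImplicit false

open MeasureTheory Filter Topology Set
open scoped ENNReal NNReal BigOperators
open Literature.MathematicalPhysics.QuantumFieldTheory.Balaban1983to89
open Literature.MathematicalPhysics.QuantumFieldTheory.Balaban1983to89.T3ContinuumYM3Torus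
open Literature.MathematicalPhysics.QuantumFieldTheory.Balaban1983to89.T3NestedUnitLaws
open Literature.MathematicalPhysics.QuantumFieldTheory.Balaban1983to89.T3UnitLawDensityEML
open Literature.MathematicalPhysics.QuantumFieldTheory.Balaban1983to89.T3UnitScaleTilt
open Literature.MathematicalPhysics.QuantumFieldTheory.Balaban1983to89.T3TiltDescent
open Literature.MathematicalPhysics.QuantumFieldTheory.Balaban1983to89.Missing
open scoped Literature.MathematicalPhysics.QuantumFieldTheory.Balaban1983to89.T3OrbitAverage
open Summit.QuantumFields.YangMills.Theorems.FluctuationComparisonRegPrIntLWregGlue (heightDensityCan)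
open Summit.QuantumFields.YangMills.Theorems.FluctuationComparisonRegPrIntLSupTailCoverUnionDepthOne (preimage_diff_histGood_subset_fine)

namespace Summit.QuantumFields.YangMills.Theorems.FluctuationComparisonRegPrIntLSupTailCoverUnionTotal

/-! ## §1 Generic: rows relative to the total mass ⇒ bad fraction ⇒ odds -/

/-- ★ **COVER ⇒ BAD FRACTION**: `A ∖ G ⊆ ⋃_{i∈s} E_i` and `μ(A ∩ E_i) ≤ σ_i·μ A` give `μ(A ∖ G) ≤ (Σ_{i∈s} σ_i)·μ A` (`ℝ≥0∞` weights; subadditivity). [folklore] -/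
theorem measure_diff_le_sum_mul_of_cover {X : Type*} [MeasurableSpace X] (μ : Measure X) {ι : Type*} (s : Finset ι) (E : ι → Set X) {A G : Set X}
    (hcover : A \ G ⊆ ⋃ i ∈ s, E i) (σ : ι → ℝ≥0∞) (hdom : ∀ i ∈ s, μ (A ∩ E i) ≤ σ i * μ A) :
    μ (A \ G) ≤ (∑ i ∈ s, σ i) * μ A := by
  calc μ (A \ G) ≤ μ (⋃ i ∈ s, (A ∩ E i)) := by
        refine measure_mono fun x hx => ?_
        have hx' := hcover hx
        simp only [Set.mem_iUnion] at hx' ⊢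
        obtain ⟨i, hi, hxi⟩ := hx'
        exact ⟨i, hi, hx.1, hxi⟩
    _ ≤ ∑ i ∈ s, μ (A ∩ E i) := measure_biUnion_finset_le s _
    _ ≤ ∑ i ∈ s, σ i * μ A := Finset.sum_le_sum fun i hi => hdom i hi
    _ = (∑ i ∈ s, σ i) * μ A := by rw [Finset.sum_mul]

/-- ★★ **TOTAL-MASS ROWS ⇒ ODDS** (finite `μ`): `A ∖ G ⊆ ⋃ E_i`, `μ(A ∩ E_i) ≤ ofReal(σ_i)·μ A` with real `σ_i ≥ 0` and `Σσ_i ≤ ½` give `μ A ≤ ofReal(e^{2Σσ_i})·μ(A ∩ G)`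
(§1 then ✓B `measure_le_exp_mul_inter_of_badFraction`: `1/(1 − x) ≤ e^{2x}` on `[0, ½]`). [folklore] -/
theorem measure_le_exp_mul_inter_of_cover_total {X : Type*} [MeasurableSpace X] (μ : Measure X) [IsFiniteMeasure μ] {ι : Type*} (s : Finset ι)
    (E : ι → Set X) {A G : Set X} (hG : MeasurableSet G) (hcover : A \ G ⊆ ⋃ i ∈ s, E i) (σ : ι → ℝ) (hσ : ∀ i ∈ s, 0 ≤ σ i)
    (hsum : ∑ i ∈ s, σ i ≤ 1 / 2) (hdom : ∀ i ∈ s, μ (A ∩ E i) ≤ ENNReal.ofReal (σ i) * μ A) :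
    μ A ≤ ENNReal.ofReal (Real.exp (2 * ∑ i ∈ s, σ i)) * μ (A ∩ G) := by
  have hbad := measure_diff_le_sum_mul_of_cover μ s E hcover (fun i => ENNReal.ofReal (σ i)) hdom
  rw [← ENNReal.ofReal_sum_of_nonneg hσ] at hbad
  exact FluctuationComparisonRegPrIntLSupTailModulus.measure_le_exp_mul_inter_of_badFraction μ hG (Finset.sum_nonneg hσ) hsum hbad

/-! ## §2 The runs, any depth: regime rows relative to the total mass above `B` -/

section Runs

variable (F : T3Family) {γ : ℝ} (hγ : 0 ≤ γ) (θ : ℕ → ℝ) {J K : ℕ} (hJK : J ≤ K)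
include hγ

/-- ★★ **COND-ODDS AT `(J, K)` ⟸ A FINITE REGIME COVER, TOTAL-MASS ROWS**: `D_{J,K}⁻¹B ∖ histGood θ K J ⊆ ⋃ E_i`, rows `Gibbs_K(D⁻¹B ∩ E_i) ≤ ofReal(σ_i)·Gibbs_K(D⁻¹B)`
(`σ_i ≥ 0`, `Σσ_i ≤ ½`) ⇒ `Gibbs_K(D⁻¹B) ≤ ofReal(e^{2Σσ_i})·Gibbs_K(D⁻¹B ∩ histGood θ K J)` (`γ ≥ 0`: the Gibbs law is a probability measure). Thresholds and window free.
[cite: Balaban1985UV3, (7) p.257 and (38)-(40) p.266] -/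
theorem condGoodOdds_of_regimeCoverTotal {ι : Type*} (s : Finset ι) (E : ι → Set (GaugeField (F.P K) 0 (Matrix.specialUnitaryGroup (Fin 2) ℂ)))
    (σ : ι → ℝ) (hσ : ∀ i ∈ s, 0 ≤ σ i) (hsum : ∑ i ∈ s, σ i ≤ 1 / 2) {B : Set (GaugeField (F.P J) 0 (Matrix.specialUnitaryGroup (Fin 2) ℂ))}
    (hcover : descendTo F ℰp J K hJK ⁻¹' B \ histGood F ℰp θ K J ⊆ ⋃ i ∈ s, E i)
    (hrows : ∀ i ∈ s, gibbsK F ℰp γ K (descendTo F ℰp J K hJK ⁻¹' B ∩ E i) ≤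
          ENNReal.ofReal (σ i) * gibbsK F ℰp γ K (descendTo F ℰp J K hJK ⁻¹' B)) :
    gibbsK F ℰp γ K (descendTo F ℰp J K hJK ⁻¹' B) ≤
      ENNReal.ofReal (Real.exp (2 * ∑ i ∈ s, σ i)) *
        gibbsK F ℰp γ K (descendTo F ℰp J K hJK ⁻¹' B ∩ histGood F ℰp θ K J) := by
  haveI := isProbabilityMeasure_gibbsK F ℰp hγ K
  exact measure_le_exp_mul_inter_of_cover_total (gibbsK F ℰp γ K) s E (measurableSet_histGood F ℰp measurableE_ℰp _ K J) hcover σ hσ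
    hsum hrows

end Runs

/-! ## §3 Depth one: fine-plaquette pinned rows relative to the total mass -/

section DepthOne

variable (F : T3Family) {γ : ℝ} (hγ : 0 ≤ γ) (θ : ℕ → ℝ) (J : ℕ)
include hγ

/-- ★★ **COND-ODDS AT `(J, J+1)` ⟸ FINE-LEVEL PINNED ROWS, TOTAL MASS**: rows `Gibbs_{J+1}(D⁻¹B ∩ {θ_{J+1} ≤ dist1(U(∂p))}) ≤ ofReal(σ_p)·Gibbs_{J+1}(D⁻¹B)` for every
plaquette `p ∈ T_{J+1}` (`σ ≥ 0`, `Σ_p σ_p ≤ ½`) and `B ⊆ {PlaqSmall (θ J)}` give `Gibbs_{J+1}(D⁻¹B) ≤ ofReal(e^{2Σ_pσ_p})·Gibbs_{J+1}(D⁻¹B ∩ histGood θ (J+1) J)`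
(✓M's depth-one cover `preimage_diff_histGood_subset_fine` + §1).  This is the edition the far door ✓H (+ ✓I, `G := univ`) feeds. [cite: Balaban1985UV3, (7) p.257 and (38)-(40) p.266] -/
theorem condGoodOddsDepthOne_of_pinnedRowsFineTotal (σ : Plaq (F.P (J + 1)) 0 → ℝ) (hσ : ∀ p, 0 ≤ σ p)
    (hsum : ∑ p : Plaq (F.P (J + 1)) 0, σ p ≤ 1 / 2)
    {B : Set (GaugeField (F.P J) 0 (Matrix.specialUnitaryGroup (Fin 2) ℂ))} (hBJ : B ⊆ {U | PlaqSmall (θ J) U})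
    (hrows : ∀ p : Plaq (F.P (J + 1)) 0,
      gibbsK F ℰp γ (J + 1) (descendTo F ℰp J (J + 1) (Nat.le_succ J) ⁻¹' B ∩ {U | θ (J + 1) ≤ dist1 (GaugeField.plaqHol U p)}) ≤
        ENNReal.ofReal (σ p) * gibbsK F ℰp γ (J + 1) (descendTo F ℰp J (J + 1) (Nat.le_succ J) ⁻¹' B)) :
    gibbsK F ℰp γ (J + 1) (descendTo F ℰp J (J + 1) (Nat.le_succ J) ⁻¹' B) ≤
      ENNReal.ofReal (Real.exp (2 * ∑ p : Plaq (F.P (J + 1)) 0, σ p)) *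
        gibbsK F ℰp γ (J + 1) (descendTo F ℰp J (J + 1) (Nat.le_succ J) ⁻¹' B ∩ histGood F ℰp θ (J + 1) J) :=
  condGoodOdds_of_regimeCoverTotal F hγ θ (Nat.le_succ J) Finset.univ (fun p => {U | θ (J + 1) ≤ dist1 (GaugeField.plaqHol U p)}) σ
    (fun p _ => hσ p) hsum (preimage_diff_histGood_subset_fine F θ J hBJ) (fun p _ => hrows p)

end DepthOne

/-! ## §4 The interior window (the live edition): ⟨PINNED-TOTAL₁∘⟩ ⇒ ✓K's ⟨COND-ODDS₁∘⟩ ⇒ TAILSUP₁∘ verbatim -/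

section Interior

/-- ★★★ **⟨PINNED-TOTAL₁∘⟩ ⇒ ✓K's ⟨COND-ODDS₁∘⟩ VERBATIM** (`τ J = 2·s J`).  ⟨PINNED-TOTAL₁∘⟩ (TAILSUP₁∘'s quantifier prefix, then): a smallness profile `s : ℕ → ℝ`, `0 ≤ s J ≤ ½`,
superpolynomially small, and weights `σ_J p ≥ 0` with `Σ_{p∈T_{J+1}} σ_J p ≤ s J`, such that for every `J`, `p ∈ T_{J+1}` and measurable `B` inside the INTERIOR height-`J` window
`{PlaqSmall (θBal L γ (c·b₀) p₀ J)}`: `Gibbs_{J+1}(D⁻¹B ∩ {θBal L γ b₀ p₀ (J+1) ≤ dist1(U(∂p))}) ≤ ofReal(σ_J p)·Gibbs_{J+1}(D⁻¹B)` (TOTAL mass above `B` on the right).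
The interior window lies inside the history's window (lit `θBal_mul_le`, `c ≤ c₀ ≤ 1`, `γ ≤ 1` — `γ₁ ↦ min γ₁ 1`). [cite: Balaban1985UV3, (2) p.256, (7) p.257 and (38)-(40) p.266] -/
theorem condGoodOddsDepthOneInt_of_pinnedTotalFineInt
    (h : ∀ (L : ℕ), ∃ c₀ : ℝ, 0 < c₀ ∧ c₀ ≤ 1 ∧ ∀ (c : ℝ), 0 < c → c ≤ c₀ → ∃ pS : ℝ, ∀ (b₀ p₀ : ℝ), 0 < b₀ → pS ≤ p₀ → 0 < p₀ →
      ∃ γ₁ : ℝ, 0 < γ₁ ∧ ∀ (F : T3Family) (γ : ℝ), F.L = L → 0 < γ → γ ≤ γ₁ →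
        ∃ (s : ℕ → ℝ) (σ : (J : ℕ) → Plaq (F.P (J + 1)) 0 → ℝ), (∀ J, 0 ≤ s J) ∧ (∀ J, s J ≤ 1 / 2) ∧
          (∀ a : ℕ, Tendsto (fun J : ℕ => ((J : ℝ) + 1) ^ a * s J) atTop (𝓝 0)) ∧ (∀ J p, 0 ≤ σ J p) ∧
          (∀ J, ∑ p : Plaq (F.P (J + 1)) 0, σ J p ≤ s J) ∧
          ∀ (J : ℕ) (p : Plaq (F.P (J + 1)) 0) (B : Set (GaugeField (F.P J) 0 (Matrix.specialUnitaryGroup (Fin 2) ℂ))), MeasurableSet B →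
            B ⊆ {U | PlaqSmall (θBal F.L γ (c * b₀) p₀ J) U} →
            gibbsK F ℰp γ (J + 1) (descendTo F ℰp J (J + 1) (Nat.le_succ J) ⁻¹' B ∩
                {U | θBal F.L γ b₀ p₀ (J + 1) ≤ dist1 (GaugeField.plaqHol U p)}) ≤
              ENNReal.ofReal (σ J p) * gibbsK F ℰp γ (J + 1) (descendTo F ℰp J (J + 1) (Nat.le_succ J) ⁻¹' B)) :
    ∀ (L : ℕ), ∃ c₀ : ℝ, 0 < c₀ ∧ c₀ ≤ 1 ∧ ∀ (c : ℝ), 0 < c → c ≤ c₀ → ∃ pS : ℝ, ∀ (b₀ p₀ : ℝ), 0 < b₀ → pS ≤ p₀ → 0 < p₀ →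
      ∃ γ₁ : ℝ, 0 < γ₁ ∧ ∀ (F : T3Family) (γ : ℝ), F.L = L → 0 < γ → γ ≤ γ₁ →
        ∃ τ : ℕ → ℝ, (∀ J, 0 ≤ τ J) ∧ (∀ a : ℕ, Tendsto (fun J : ℕ => ((J : ℝ) + 1) ^ a * τ J) atTop (𝓝 0)) ∧
          ∀ (J : ℕ) (B : Set (GaugeField (F.P J) 0 (Matrix.specialUnitaryGroup (Fin 2) ℂ))), MeasurableSet B →
            B ⊆ {U | PlaqSmall (θBal F.L γ (c * b₀) p₀ J) U} →
            gibbsK F ℰp γ (J + 1) (descendTo F ℰp J (J + 1) (Nat.le_succ J) ⁻¹' B) ≤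
              ENNReal.ofReal (Real.exp (τ J)) *
                gibbsK F ℰp γ (J + 1) (descendTo F ℰp J (J + 1) (Nat.le_succ J) ⁻¹' B ∩ histGood F ℰp (θBal F.L γ b₀ p₀) (J + 1) J) := by
  intro L
  obtain ⟨c₀, hc₀, hc₀1, hc⟩ := h L
  refine ⟨c₀, hc₀, hc₀1, fun c hcpos hcle => ?_⟩
  obtain ⟨pS, hpS⟩ := hc c hcpos hcle
  refine ⟨pS, fun b₀ p₀ hb₀ hpS' hp₀ => ?_⟩
  obtain ⟨γ₁, hγ₁, hγ₁F⟩ := hpS b₀ p₀ hb₀ hpS' hp₀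
  refine ⟨min γ₁ 1, lt_min hγ₁ one_pos, fun F γ hFL hγ hγle => ?_⟩
  have hγ1 : γ ≤ 1 := le_trans hγle (min_le_right γ₁ 1)
  obtain ⟨s, σ, hs0, hshalf, hsa, hσ0, hσs, hrows⟩ := hγ₁F F γ hFL hγ (le_trans hγle (min_le_left γ₁ 1))
  refine ⟨fun J => 2 * s J, fun J => by linarith [hs0 J], fun a => ?_, ?_⟩
  · have := (hsa a).const_mul 2
    rw [mul_zero] at this
    refine this.congr' (Eventually.of_forall fun J => ?_)
    simp only
    ring
  intro J B hB hBW
  -- the interior window lies inside the history's level-`J` window (`c ≤ c₀ ≤ 1`, `γ ≤ 1`)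
  have hBJ : B ⊆ {U : GaugeField (F.P J) 0 (Matrix.specialUnitaryGroup (Fin 2) ℂ) | PlaqSmall (θBal F.L γ b₀ p₀ J) U} := fun U hU =>
    T3PrintedMinimiserExistence.plaqSmall_of_le
      (T3InteriorExcision.θBal_mul_le (le_of_lt F.hL.2) hγ hγ1 hb₀ (hcle.trans hc₀1) p₀ J) (hBW hU)
  have hmain := condGoodOddsDepthOne_of_pinnedRowsFineTotal F hγ.le (θBal F.L γ b₀ p₀) J (σ J) (hσ0 J) ((hσs J).trans (hshalf J)) hBJ
    (fun p => hrows J p B hB hBW)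
  refine hmain.trans (mul_le_mul' (ENNReal.ofReal_le_ofReal (Real.exp_le_exp.mpr ?_)) le_rfl)
  linarith [hσs J]

/-- ★★★ **⟨PINNED-TOTAL₁∘⟩ ⇒ TAILSUP₁∘** (LINE g21-2 v1.4's interior row `RunPairOrgan.OneLoop.WindowOddsSupDepthOneIntCan`, text verbatim): §4 then ✓K
`windowOddsSupDepthOneIntCan_of_condGoodOddsDepthOneInt`.  HONEST SCOPE: the total-mass pinned rows + smallness `s ≤ ½` are the HYPOTHESIS; nothing upstream is proved.
[cite: Balaban1985UV3, (2) p.256, (7) p.257, (38)-(40) p.266 and (71) p.273] -/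
theorem windowOddsSupDepthOneInt_of_pinnedTotalFineInt
    (h : ∀ (L : ℕ), ∃ c₀ : ℝ, 0 < c₀ ∧ c₀ ≤ 1 ∧ ∀ (c : ℝ), 0 < c → c ≤ c₀ → ∃ pS : ℝ, ∀ (b₀ p₀ : ℝ), 0 < b₀ → pS ≤ p₀ → 0 < p₀ →
      ∃ γ₁ : ℝ, 0 < γ₁ ∧ ∀ (F : T3Family) (γ : ℝ), F.L = L → 0 < γ → γ ≤ γ₁ →
        ∃ (s : ℕ → ℝ) (σ : (J : ℕ) → Plaq (F.P (J + 1)) 0 → ℝ), (∀ J, 0 ≤ s J) ∧ (∀ J, s J ≤ 1 / 2) ∧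
          (∀ a : ℕ, Tendsto (fun J : ℕ => ((J : ℝ) + 1) ^ a * s J) atTop (𝓝 0)) ∧ (∀ J p, 0 ≤ σ J p) ∧
          (∀ J, ∑ p : Plaq (F.P (J + 1)) 0, σ J p ≤ s J) ∧
          ∀ (J : ℕ) (p : Plaq (F.P (J + 1)) 0) (B : Set (GaugeField (F.P J) 0 (Matrix.specialUnitaryGroup (Fin 2) ℂ))), MeasurableSet B →
            B ⊆ {U | PlaqSmall (θBal F.L γ (c * b₀) p₀ J) U} →
            gibbsK F ℰp γ (J + 1) (descendTo F ℰp J (J + 1) (Nat.le_succ J) ⁻¹' B ∩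
                {U | θBal F.L γ b₀ p₀ (J + 1) ≤ dist1 (GaugeField.plaqHol U p)}) ≤
              ENNReal.ofReal (σ J p) * gibbsK F ℰp γ (J + 1) (descendTo F ℰp J (J + 1) (Nat.le_succ J) ⁻¹' B)) :
    ∀ (L : ℕ), ∃ c₀ : ℝ, 0 < c₀ ∧ c₀ ≤ 1 ∧ ∀ (c : ℝ), 0 < c → c ≤ c₀ → ∃ pS : ℝ, ∀ (b₀ p₀ : ℝ), 0 < b₀ → pS ≤ p₀ → 0 < p₀ →
    ∃ γ₁ : ℝ, 0 < γ₁ ∧ ∀ (F : T3Family) (γ : ℝ), F.L = L → 0 < γ → γ ≤ γ₁ →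
      ∃ τ : ℕ → ℝ, (∀ J, 0 ≤ τ J) ∧ (∀ a : ℕ, Tendsto (fun J : ℕ => ((J : ℝ) + 1) ^ a * τ J) atTop (𝓝 0)) ∧
        ∀ (ν : ℕ → (j : ℕ) → Measure (GaugeField (F.P j) 0 (Matrix.specialUnitaryGroup (Fin 2) ℂ))),
          (∀ K, ν K K = T4GenFunBounds.gibbsMeasure (F.P K) ((F.scheme ℰp γ).β K)) →
          (∀ K j, j < K → ν K j = Measure.map (descend F ℰp j) (ν K (j + 1))) →
          ∀ (J : ℕ) (ρ : GaugeField (F.P J) 0 (Matrix.specialUnitaryGroup (Fin 2) ℂ) → ℝ),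
            (∀ U, PlaqSmall (θBal F.L γ (c * b₀) p₀ J) U → 0 < ρ U) →
            ν (J + 1) J = (fieldMeasure _ _ _).withDensity (fun U => ENNReal.ofReal (ρ U)) →
            ContinuousOn ρ {U | PlaqSmall (θBal F.L γ (c * b₀) p₀ J) U} →
            (∀ U : GaugeField (F.P J) 0 (Matrix.specialUnitaryGroup (Fin 2) ℂ), PlaqSmall (θBal F.L γ (c * b₀) p₀ J) U →
                0 < heightDensityCan F γ (Nat.le_succ J) (histGood F ℰp (θBal F.L γ b₀ p₀) (J + 1) J) U) →
            ∃ a₀ : ℝ, ∀ U : GaugeField (F.P J) 0 (Matrix.specialUnitaryGroup (Fin 2) ℂ), PlaqSmall (θBal F.L γ (c * b₀) p₀ J) U →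
              0 ≤ Real.log (ρ U) - a₀ - Real.log (heightDensityCan F γ (Nat.le_succ J) (histGood F ℰp (θBal F.L γ b₀ p₀) (J + 1) J) U) ∧
              Real.log (ρ U) - a₀ - Real.log (heightDensityCan F γ (Nat.le_succ J) (histGood F ℰp (θBal F.L γ b₀ p₀) (J + 1) J) U) ≤ τ J :=
  FluctuationComparisonRegPrIntLSupTailReductionInt.windowOddsSupDepthOneIntCan_of_condGoodOddsDepthOneInt
    (condGoodOddsDepthOneInt_of_pinnedTotalFineInt h)

end Interior

/-! ## §5 The full-window twins: ⟨PINNED-TOTAL₁⟩ ⇒ ✓A's ⟨COND-ODDS₁⟩ ⇒ TAILSUP₁ verbatim -/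

section Full

/-- ★★ **⟨PINNED-TOTAL₁⟩ ⇒ ✓A's ⟨COND-ODDS₁⟩ VERBATIM** (`τ J = 2·s J`; full window: `B ⊆ {PlaqSmall (θBal L γ b₀ p₀ J)}` is itself the history's level-`J` window).
[cite: Balaban1985UV3, (7) p.257 and (38)-(40) p.266] -/
theorem condGoodOddsDepthOne_of_pinnedTotalFine
    (h : ∀ (L : ℕ), ∃ pS : ℝ, ∀ (b₀ p₀ : ℝ), 0 < b₀ → pS ≤ p₀ → 0 < p₀ →
      ∃ γ₁ : ℝ, 0 < γ₁ ∧ ∀ (F : T3Family) (γ : ℝ), F.L = L → 0 < γ → γ ≤ γ₁ →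
        ∃ (s : ℕ → ℝ) (σ : (J : ℕ) → Plaq (F.P (J + 1)) 0 → ℝ), (∀ J, 0 ≤ s J) ∧ (∀ J, s J ≤ 1 / 2) ∧
          (∀ a : ℕ, Tendsto (fun J : ℕ => ((J : ℝ) + 1) ^ a * s J) atTop (𝓝 0)) ∧ (∀ J p, 0 ≤ σ J p) ∧
          (∀ J, ∑ p : Plaq (F.P (J + 1)) 0, σ J p ≤ s J) ∧
          ∀ (J : ℕ) (p : Plaq (F.P (J + 1)) 0) (B : Set (GaugeField (F.P J) 0 (Matrix.specialUnitaryGroup (Fin 2) ℂ))), MeasurableSet B →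
            B ⊆ {U | PlaqSmall (θBal F.L γ b₀ p₀ J) U} →
            gibbsK F ℰp γ (J + 1) (descendTo F ℰp J (J + 1) (Nat.le_succ J) ⁻¹' B ∩
                {U | θBal F.L γ b₀ p₀ (J + 1) ≤ dist1 (GaugeField.plaqHol U p)}) ≤
              ENNReal.ofReal (σ J p) * gibbsK F ℰp γ (J + 1) (descendTo F ℰp J (J + 1) (Nat.le_succ J) ⁻¹' B)) :
    ∀ (L : ℕ), ∃ pS : ℝ, ∀ (b₀ p₀ : ℝ), 0 < b₀ → pS ≤ p₀ → 0 < p₀ →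
      ∃ γ₁ : ℝ, 0 < γ₁ ∧ ∀ (F : T3Family) (γ : ℝ), F.L = L → 0 < γ → γ ≤ γ₁ →
        ∃ τ : ℕ → ℝ, (∀ J, 0 ≤ τ J) ∧ (∀ a : ℕ, Tendsto (fun J : ℕ => ((J : ℝ) + 1) ^ a * τ J) atTop (𝓝 0)) ∧
          ∀ (J : ℕ) (B : Set (GaugeField (F.P J) 0 (Matrix.specialUnitaryGroup (Fin 2) ℂ))), MeasurableSet B →
            B ⊆ {U | PlaqSmall (θBal F.L γ b₀ p₀ J) U} →
            gibbsK F ℰp γ (J + 1) (descendTo F ℰp J (J + 1) (Nat.le_succ J) ⁻¹' B) ≤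
              ENNReal.ofReal (Real.exp (τ J)) *
                gibbsK F ℰp γ (J + 1) (descendTo F ℰp J (J + 1) (Nat.le_succ J) ⁻¹' B ∩ histGood F ℰp (θBal F.L γ b₀ p₀) (J + 1) J) := by
  intro L
  obtain ⟨pS, hpS⟩ := h L
  refine ⟨pS, fun b₀ p₀ hb₀ hpS' hp₀ => ?_⟩
  obtain ⟨γ₁, hγ₁, hγ₁F⟩ := hpS b₀ p₀ hb₀ hpS' hp₀
  refine ⟨γ₁, hγ₁, fun F γ hFL hγ hγle => ?_⟩
  obtain ⟨s, σ, hs0, hshalf, hsa, hσ0, hσs, hrows⟩ := hγ₁F F γ hFL hγ hγle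
  refine ⟨fun J => 2 * s J, fun J => by linarith [hs0 J], fun a => ?_, ?_⟩
  · have := (hsa a).const_mul 2
    rw [mul_zero] at this
    refine this.congr' (Eventually.of_forall fun J => ?_)
    simp only
    ring
  intro J B hB hBW
  have hmain := condGoodOddsDepthOne_of_pinnedRowsFineTotal F hγ.le (θBal F.L γ b₀ p₀) J (σ J) (hσ0 J) ((hσs J).trans (hshalf J)) hBW
    (fun p => hrows J p B hB hBW)
  refine hmain.trans (mul_le_mul' (ENNReal.ofReal_le_ofReal (Real.exp_le_exp.mpr ?_)) le_rfl)
  linarith [hσs J]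

/-- ★★ **⟨PINNED-TOTAL₁⟩ ⇒ TAILSUP₁** (LINE g21-1's row `RunPairOrgan.OneLoop.WindowOddsSupDepthOneCan`, text verbatim): §5 then ✓A `windowOddsSupDepthOneCan_of_condGoodOddsDepthOne`.
HONEST SCOPE: full-window edition (R3-FLIN exposes the full-window MODERATE rows at `L = 3, 5`; §4 is the live one). [cite: Balaban1985UV3, (7) p.257, (38)-(40) p.266 and (71) p.273] -/
theorem windowOddsSupDepthOne_of_pinnedTotalFine
    (h : ∀ (L : ℕ), ∃ pS : ℝ, ∀ (b₀ p₀ : ℝ), 0 < b₀ → pS ≤ p₀ → 0 < p₀ →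
      ∃ γ₁ : ℝ, 0 < γ₁ ∧ ∀ (F : T3Family) (γ : ℝ), F.L = L → 0 < γ → γ ≤ γ₁ →
        ∃ (s : ℕ → ℝ) (σ : (J : ℕ) → Plaq (F.P (J + 1)) 0 → ℝ), (∀ J, 0 ≤ s J) ∧ (∀ J, s J ≤ 1 / 2) ∧
          (∀ a : ℕ, Tendsto (fun J : ℕ => ((J : ℝ) + 1) ^ a * s J) atTop (𝓝 0)) ∧ (∀ J p, 0 ≤ σ J p) ∧
          (∀ J, ∑ p : Plaq (F.P (J + 1)) 0, σ J p ≤ s J) ∧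
          ∀ (J : ℕ) (p : Plaq (F.P (J + 1)) 0) (B : Set (GaugeField (F.P J) 0 (Matrix.specialUnitaryGroup (Fin 2) ℂ))), MeasurableSet B →
            B ⊆ {U | PlaqSmall (θBal F.L γ b₀ p₀ J) U} →
            gibbsK F ℰp γ (J + 1) (descendTo F ℰp J (J + 1) (Nat.le_succ J) ⁻¹' B ∩
                {U | θBal F.L γ b₀ p₀ (J + 1) ≤ dist1 (GaugeField.plaqHol U p)}) ≤
              ENNReal.ofReal (σ J p) * gibbsK F ℰp γ (J + 1) (descendTo F ℰp J (J + 1) (Nat.le_succ J) ⁻¹' B)) :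
    ∀ (L : ℕ), ∃ pS : ℝ, ∀ (b₀ p₀ : ℝ), 0 < b₀ → pS ≤ p₀ → 0 < p₀ →
      ∃ γ₁ : ℝ, 0 < γ₁ ∧ ∀ (F : T3Family) (γ : ℝ), F.L = L → 0 < γ → γ ≤ γ₁ →
        ∃ τ : ℕ → ℝ, (∀ J, 0 ≤ τ J) ∧ (∀ a : ℕ, Tendsto (fun J : ℕ => ((J : ℝ) + 1) ^ a * τ J) atTop (𝓝 0)) ∧
          ∀ (ν : ℕ → (j : ℕ) → Measure (GaugeField (F.P j) 0 (Matrix.specialUnitaryGroup (Fin 2) ℂ))),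
            (∀ K, ν K K = T4GenFunBounds.gibbsMeasure (F.P K) ((F.scheme ℰp γ).β K)) →
            (∀ K j, j < K → ν K j = Measure.map (descend F ℰp j) (ν K (j + 1))) →
            ∀ (J : ℕ) (ρ : GaugeField (F.P J) 0 (Matrix.specialUnitaryGroup (Fin 2) ℂ) → ℝ),
              (∀ U, PlaqSmall (θBal F.L γ b₀ p₀ J) U → 0 < ρ U) →
              ν (J + 1) J = (fieldMeasure _ _ _).withDensity (fun U => ENNReal.ofReal (ρ U)) →
              ContinuousOn ρ {U | PlaqSmall (θBal F.L γ b₀ p₀ J) U} →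
              (∀ U : GaugeField (F.P J) 0 (Matrix.specialUnitaryGroup (Fin 2) ℂ), PlaqSmall (θBal F.L γ b₀ p₀ J) U →
                  0 < heightDensityCan F γ (Nat.le_succ J) (histGood F ℰp (θBal F.L γ b₀ p₀) (J + 1) J) U) →
              ∃ c : ℝ, ∀ U : GaugeField (F.P J) 0 (Matrix.specialUnitaryGroup (Fin 2) ℂ), PlaqSmall (θBal F.L γ b₀ p₀ J) U →
                0 ≤ Real.log (ρ U) - c - Real.log (heightDensityCan F γ (Nat.le_succ J) (histGood F ℰp (θBal F.L γ b₀ p₀) (J + 1) J) U) ∧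
                Real.log (ρ U) - c - Real.log (heightDensityCan F γ (Nat.le_succ J) (histGood F ℰp (θBal F.L γ b₀ p₀) (J + 1) J) U) ≤ τ J :=
  FluctuationComparisonRegPrIntLSupTailReduction.windowOddsSupDepthOneCan_of_condGoodOddsDepthOne (condGoodOddsDepthOne_of_pinnedTotalFine h)

end Full

end Summit.QuantumFields.YangMills.Theorems.FluctuationComparisonRegPrIntLSupTailCoverUnionTotal

end
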